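import Summits.SmoothPoincare4.SmoothPoincare4.Theorems.SymplecticOrigamiGromovRecognitionRelEndHelperNwtCrossingIndex
import Summits.SmoothPoincare4.SmoothPoincare4.Theorems.SymplecticOrigamiGromovRecognitionRelEndHelperLocalIndexOfSection
import Literature.Topology.FourManifolds.NullhomotopicNormalFraming
import Literature.Topology.FourManifolds.ProjectiveLineRotationField
import Summits.SmoothPoincare4.SmoothPoincare4.Theorems.SymplecticOrigamiGromovRecognitionRelEndHelperSectionOverDisc
import Summits.SmoothPoincare4.SmoothPoincare4.Theorems.SymplecticOrigamiGromovRecognitionRelEndHelperPosFrameAlongSurfaceConstC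
import Summits.SmoothPoincare4.SmoothPoincare4.Theorems.SymplecticOrigamiGromovRecognitionRelEndHelperPosFrameOfLocalDiffeoConst

/-!
# Crossing helper for `GromovRecognitionRelEnd` (line cross-cap-laurent): the local indices sum to zero

Support lemma for crux `stmt-SmoothPoincare4-11009` (child stub `stub_normalWitnessTransfer` of the split
piece `AdjunctionEmbeddedSpheres`), Kirby 1989, Ch. VIII, proof of Thm. 2. In a Whitney picture `D` of the
embedded sphere `Σ = b(ℂℙ¹)` with chart `u = b ∘ linePt 0`, Kirby's plane field `P` (`D.planeField`) with
rotation `Rot` and tautological section `sec`, and an immersed slice `Φ (·, s)` of a fibration `g` crossing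
`Σ` transversally at the parameters `ζ ∈ ZK` (`Φ (ζ, s) = u (zc ζ)`): if the intersection signs of `g ∘ u` at
the crossings sum to zero, then so do the local indices (`wind φ`) of `sec` along the slice, read in a disc
frame `t` of `P`.

Proof: at each crossing `helper_nwtCrossingIndex` expresses the local index `±1` through the transversality
sign `q` and the determinant identity `d · det[dΣ | N] = ‖τ‖⁴ · det[dΦ] · q`; the orientation characters of the
frames `[dΣ | N]` (normal frame `N ↦ (n, Jn)`, `n` a normal section of `Σ` over the chart disc,
`helper_sectionOverDisc`) and `[dΦ]` are constant (`helper_posFrameAlongSurfaceConstC`,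
`helper_posFrameOfLocalDiffeoConst`), so `wind φ = ±(sign of g ∘ u)` with a sign independent of the crossing,
and the sum vanishes with the signed count.
-/

noncomputable section

open scoped Manifold ContDiff Topology
open Set Function Metric Literature.Topology.FourManifolds Literature.Topology.PlaneTopology
  Literature.Topology.FourManifolds.NormalEuler

set_option linter.dupNamespace false

namespace Summit.SmoothPoincare4.SmoothPoincare4.Theorems.GromovRecognitionRelEnd.CrossCapLaurent

/-- Sign bookkeeping: from `d * b = τ * (p * q)` with `0 < τ` and `d, q, b ≠ 0`, the sign of `d` is the product of the
signs of `b`, `p`, `q` (signs read as `±1 : ℤ`). -/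
theorem helper_nwtIndexSum_sgnRule {d q b p τ : ℝ} (hτ : 0 < τ) (hd : d ≠ 0) (hq : q ≠ 0) (hb : b ≠ 0) (h : d * b = τ * (p * q)) :
    (if 0 < d then (1 : ℤ) else -1) =
      (if 0 < b then (1 : ℤ) else -1) * (if 0 < p then (1 : ℤ) else -1) * (if 0 < q then (1 : ℤ) else -1) := by
  have hp : p ≠ 0 := by
    rintro rfl
    rw [zero_mul, mul_zero, mul_eq_zero] at h
    exact h.elim hd hb
  have key : 0 < d * (b * (p * q)) := by
    have : d * (b * (p * q)) = τ * ((p * q) * (p * q)) := by rw [← mul_assoc, h]; ring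
    rw [this]; exact mul_pos hτ (mul_self_pos.2 (mul_ne_zero hp hq))
  rcases lt_or_gt_of_ne hb with hb' | hb' <;> rcases lt_or_gt_of_ne hp with hp' | hp' <;> rcases lt_or_gt_of_ne hq with hq' | hq'
  · have hbpq : b * (p * q) < 0 := mul_neg_of_neg_of_pos hb' (mul_pos_of_neg_of_neg hp' hq')
    have hd' : d < 0 := by nlinarith
    rw [if_neg (not_lt.2 hd'.le), if_neg (not_lt.2 hb'.le), if_neg (not_lt.2 hp'.le), if_neg (not_lt.2 hq'.le)]; norm_num
  · have hbpq : 0 < b * (p * q) := mul_pos_of_neg_of_neg hb' (mul_neg_of_neg_of_pos hp' hq')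
    have hd' : 0 < d := by nlinarith
    rw [if_pos hd', if_neg (not_lt.2 hb'.le), if_neg (not_lt.2 hp'.le), if_pos hq']; norm_num
  · have hbpq : 0 < b * (p * q) := mul_pos_of_neg_of_neg hb' (mul_neg_of_pos_of_neg hp' hq')
    have hd' : 0 < d := by nlinarith
    rw [if_pos hd', if_neg (not_lt.2 hb'.le), if_pos hp', if_neg (not_lt.2 hq'.le)]; norm_num
  · have hbpq : b * (p * q) < 0 := mul_neg_of_neg_of_pos hb' (mul_pos hp' hq')
    have hd' : d < 0 := by nlinarith
    rw [if_neg (not_lt.2 hd'.le), if_neg (not_lt.2 hb'.le), if_pos hp', if_pos hq']; norm_num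
  · have hbpq : 0 < b * (p * q) := mul_pos hb' (mul_pos_of_neg_of_neg hp' hq')
    have hd' : 0 < d := by nlinarith
    rw [if_pos hd', if_pos hb', if_neg (not_lt.2 hp'.le), if_neg (not_lt.2 hq'.le)]; norm_num
  · have hbpq : b * (p * q) < 0 := mul_neg_of_pos_of_neg hb' (mul_neg_of_neg_of_pos hp' hq')
    have hd' : d < 0 := by nlinarith
    rw [if_neg (not_lt.2 hd'.le), if_pos hb', if_neg (not_lt.2 hp'.le), if_pos hq']; norm_num
  · have hbpq : b * (p * q) < 0 := mul_neg_of_pos_of_neg hb' (mul_neg_of_pos_of_neg hp' hq')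
    have hd' : d < 0 := by nlinarith
    rw [if_neg (not_lt.2 hd'.le), if_pos hb', if_pos hp', if_neg (not_lt.2 hq'.le)]; norm_num
  · have hbpq : 0 < b * (p * q) := mul_pos hb' (mul_pos hp' hq')
    have hd' : 0 < d := by nlinarith
    rw [if_pos hd', if_pos hb', if_pos hp', if_pos hq']; norm_num

set_option maxHeartbeats 800000 in
/-- **The local indices of the tautological section along a transverse slice sum to zero** when the signed
count of the crossings does (Kirby 1989, Ch. VIII, proof of Thm. 2: `Σ indices = K · Σ = 0`). -/
theorem helper_nwtIndexSum : ∀ (m : ℕ) (X : Type) [TopologicalSpace X] [T2Space X] [SecondCountableTopology X] [ChartedSpace (EuclideanSpace ℝ (Fin 4)) X] [IsManifold (𝓡 4) ∞ X] (D : Literature.Topology.FourManifolds.CodimTwoData 2 X (Literature.Topology.FourManifolds.ComplexProjectiveSpace 1) (EuclideanSpace ℝ (Fin m))) (J : Literature.Topology.FourManifolds.ComplexProjectiveSpace 1 → EuclideanSpace ℝ (Fin m) →L[ℝ] EuclideanSpace ℝ (Fin m)) (ε δ : ℝ) (Rot : EuclideanSpace ℝ (Fin m) → (EuclideanSpace ℝ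 (Fin m) × EuclideanSpace ℝ (Fin 2)) →L[ℝ] (EuclideanSpace ℝ (Fin m) × EuclideanSpace ℝ (Fin 2))) (sec : EuclideanSpace ℝ (Fin m) → EuclideanSpace ℝ (Fin m) × EuclideanSpace ℝ (Fin 2)) (Φ : ℂ × ℂ → X) (g : X → ℂ) (UK : Set X) (u : ℂ → X) (o : Literature.Topology.FourManifolds.SmoothOrientation (𝓡 4) X) (s : ℂ) (zc : ℂ → ℂ) (ZK : Finset ℂ) (t : ℂ → EuclideanSpace ℝ (Fin m) × EuclideanSpace ℝ (Fin 2)) (φ : ℂ → ℂ), D.IsRotationField J → D.IsTubeRadius ε → 0 < δ → δ ≤ ε → ContinuousOn (D.planeField J ε δ) (Set.range D.e) → ContinuousOn Rot (Set.range D.e) → (∀ z ∈ Set.range D.e, (∀ v, D.planeField J ε δ z (D.planeField J ε δ z v) = D.planeField J ε δ z v) ∧ (∀ v, D.planeField J ε δ z (Rot z v) = Rot z v) ∧ (∀ v, Rot z (D.planeField J ε δ z v) = Rot z v) ∧ (∀ v, Rot z (Rot z v) = - D.planeField J ε δ z v) ∧ (∀ v, inner ℝ (Rot z v).1 (D.planeField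 J ε δ z v).1 + inner ℝ (Rot z v).2 (D.planeField J ε δ z v).2 = 0) ∧ (∀ v, inner ℝ (Rot z v).1 (Rot z v).1 + inner ℝ (Rot z v).2 (Rot z v).2 = inner ℝ (D.planeField J ε δ z v).1 (D.planeField J ε δ z v).1 + inner ℝ (D.planeField J ε δ z v).2 (D.planeField J ε δ z v).2) ∧ D.planeField J ε δ z ≠ 0 ∧ (∀ v w', D.planeField J ε δ z v = v → v ≠ 0 → D.planeField J ε δ z w' = w' → w' = ((inner ℝ w'.1 v.1 + inner ℝ w'.2 v.2) / (inner ℝ v.1 v.1 + inner ℝ v.2 v.2)) • v + ((inner ℝ w'.1 (Rot z v).1 + inner ℝ w'.2 (Rot z v).2) / (inner ℝ v.1 v.1 + inner ℝ v.2 v.2)) • Rot z v)) → (∀ z, Metric.infDist z D.img ≤ δ / 2 → ∀ v, Rot z v = (J (D.nearPt ε z) (D.Q (D.nearPt ε z) v.1), 0)) → (∀ z, Metric.infDist z D.img ≤ δ / 2 → sec z = (‖D.wVec ε z‖⁻¹ • D.wVec ε z, 0)) → ContMDiff 𝓘(ℝ, ℂ × ℂ) (𝓡 4) ∞ Φ →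 (∀ q, Function.Injective (mfderiv 𝓘(ℝ, ℂ × ℂ) (𝓡 4) Φ q)) → IsOpen UK → ContMDiffOn (𝓡 4) 𝓘(ℝ, ℂ) ∞ g UK → (∀ q, Φ q ∈ UK) → (∀ q, g (Φ q) = q.2) → ContMDiff 𝓘(ℝ, ℂ) (𝓡 4) ∞ u → (∀ z, D.b (Literature.Topology.FourManifolds.CodimTwoData.linePt 0 z) = u z) → (∀ z, Function.Injective (mfderiv 𝓘(ℝ, ℂ) (𝓡 4) u z)) → (∀ ζ ∈ ZK, Φ (ζ, s) = u (zc ζ)) → (∀ ζ ∈ ZK, Function.Surjective (mfderiv 𝓘(ℝ, ℂ) 𝓘(ℝ, ℂ) (fun z => g (u z)) (zc ζ))) → (∀ ζ ∈ ZK, ∃ ρ : ℝ, 0 < ρ ∧ ContinuousOn t (Metric.ball ζ ρ) ∧ ∀ ζ' ∈ Metric.ball ζ ρ, D.planeField J ε δ (D.e (Φ (ζ', s))) (t ζ') = t ζ' ∧ t ζ' ≠ 0) → (∀ ζ, φ ζ = ((inner ℝ (sec (D.e (Φ (ζ, s)))).1 (t ζ).1 + inner ℝ (sec (D.e (Φ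 (ζ, s)))).2 (t ζ).2 : ℝ) : ℂ) + ((inner ℝ (sec (D.e (Φ (ζ, s)))).1 (Rot (D.e (Φ (ζ, s))) (t ζ)).1 + inner ℝ (sec (D.e (Φ (ζ, s)))).2 (Rot (D.e (Φ (ζ, s))) (t ζ)).2 : ℝ) : ℂ) * Complex.I) → (∃ r₀ : ℝ, 0 < r₀ ∧ ∀ r : ℝ, 0 < r → r ≤ r₀ → ∑ ζ ∈ ZK, Literature.Topology.PlaneTopology.wind (fun θ => g (u (Literature.Topology.PlaneTopology.circleLoop (zc ζ) r θ)) - s) = 0) → ∃ r₀ : ℝ, 0 < r₀ ∧ ∀ r : ℝ, 0 < r → r ≤ r₀ → (∀ ζ ∈ ZK, Literature.Topology.PlaneTopology.IsNonvanishingLoop (fun θ => φ (Literature.Topology.PlaneTopology.circleLoop ζ r θ))) ∧ ∑ ζ ∈ ZK, Literature.Topology.PlaneTopology.wind (fun θ => φ (Literature.Topology.PlaneTopology.circleLoop ζ r θ)) = 0 := by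
  intro m X _ _ _ _ _ D J ε δ Rot sec Φ g UK u o s zc ZK t φ hJ hε hδ hδε hPc hRotc hOPF hRotIn hSecIn hΦ hΦd hUK hg hΦU hgΦ
    hu hbu himm hzc hreg ht hφ hcount
  classical
  -- STEP 1: a continuous nowhere-zero normal section `n` of `Σ` over a disc of the affine chart containing all `zc ζ`
  obtain ⟨RS, hRS, hRSZ⟩ : ∃ RS : ℝ, 0 < RS ∧ ∀ ζ ∈ ZK, ‖zc ζ‖ < RS := by
    refine ⟨(ZK.sup fun ζ => ‖zc ζ‖₊ : NNReal) + 1, by positivity, fun ζ hζ => ?_⟩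
    have h1 : (‖zc ζ‖₊ : ℝ) ≤ (ZK.sup fun ζ => ‖zc ζ‖₊ : NNReal) := by
      exact_mod_cast Finset.le_sup (f := fun ζ => ‖zc ζ‖₊) hζ
    rw [coe_nnnorm] at h1
    linarith
  have hQc : Continuous fun z : ℂ => D.Q (CodimTwoData.linePt 0 z) :=
    D.contMDiff_Q.continuous.comp (CodimTwoData.continuous_linePt 0)
  obtain ⟨n₀, hn₀F, hn₀⟩ : ∃ n₀ : EuclideanSpace ℝ (Fin m), n₀ ∈ D.F (CodimTwoData.linePt 0 0) ∧ n₀ ≠ 0 := by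
    have hpos : 0 < Module.finrank ℝ (D.F (CodimTwoData.linePt 0 0)) := by
      rw [show D.F (CodimTwoData.linePt 0 0) = ((D.TS _)ᗮ ⊓ D.TX _) from rfl, D.finrank_F_eq_two]; norm_num
    obtain ⟨v, hv⟩ := (Module.finrank_pos_iff_exists_ne_zero).1 hpos
    exact ⟨v.1, v.2, fun h => hv (Subtype.ext h)⟩
  obtain ⟨n, hnc, hn⟩ := helper_sectionOverDisc (EuclideanSpace ℝ (Fin m)) (fun z => D.Q (CodimTwoData.linePt 0 z)) RS n₀ hRS
    hQc.continuousOn (fun z _ v => D.Q_Q _ v) (Submodule.starProjection_eq_self_iff.2 hn₀F) hn₀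
  -- facts about `n` on the closed disc
  have hnF : ∀ z ∈ closedBall (0 : ℂ) RS, n z ∈ D.F (CodimTwoData.linePt 0 z) := fun z hz =>
    Submodule.starProjection_eq_self_iff.1 (hn z hz).1
  have hnTX : ∀ z ∈ closedBall (0 : ℂ) RS, n z ∈ D.TX (CodimTwoData.linePt 0 z) := fun z hz => D.F_le_TX _ (hnF z hz)
  have hJnTX : ∀ z ∈ closedBall (0 : ℂ) RS, J (CodimTwoData.linePt 0 z) (n z) ∈ D.TX (CodimTwoData.linePt 0 z) := fun z _ =>
    D.F_le_TX _ (hJ.apply_mem _ _)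
  -- pulled-back normal frame `N₁ N₂` (preimages under `de`)
  have hex : ∀ z, ∃ N : EuclideanSpace ℝ (Fin 4) × EuclideanSpace ℝ (Fin 4), z ∈ closedBall (0 : ℂ) RS →
      mfderiv (𝓡 4) 𝓘(ℝ, EuclideanSpace ℝ (Fin m)) D.e (D.b (CodimTwoData.linePt 0 z)) N.1 = n z ∧
      mfderiv (𝓡 4) 𝓘(ℝ, EuclideanSpace ℝ (Fin m)) D.e (D.b (CodimTwoData.linePt 0 z)) N.2 = J (CodimTwoData.linePt 0 z) (n z) := by
    intro z
    by_cases hz : z ∈ closedBall (0 : ℂ) RS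
    · obtain ⟨a, ha⟩ := (D.mem_TX_iff).1 (hnTX z hz)
      obtain ⟨a', ha'⟩ := (D.mem_TX_iff).1 (hJnTX z hz)
      exact ⟨(a, a'), fun _ => ⟨ha, ha'⟩⟩
    · exact ⟨(0, 0), fun h => (hz h).elim⟩
  choose Nf hNf using hex
  -- STEP 2: the frame `[du | N₁ N₂]` along `Σ` is linearly independent and has constant orientation character on the open disc
  set O : Set ℂ := ball (0 : ℂ) RS with hOdef
  have hOsub : O ⊆ closedBall (0 : ℂ) RS := ball_subset_closedBall
  have hσ : ContMDiff 𝓘(ℝ, ℂ) (𝓡 2) ∞ (CodimTwoData.linePt 0) := CodimTwoData.contMDiff_linePt 0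
  have hbu' : (fun z => D.b (CodimTwoData.linePt 0 z)) = u := funext hbu
  have hlin : ∀ z ∈ O, LinearIndependent ℝ ![mfderiv 𝓘(ℝ, ℂ) (𝓡 4) (fun z => D.b (CodimTwoData.linePt 0 z)) z (1 : ℂ),
      mfderiv 𝓘(ℝ, ℂ) (𝓡 4) (fun z => D.b (CodimTwoData.linePt 0 z)) z Complex.I, (Nf z).1, (Nf z).2] := by
    intro z hz
    have hz' := hOsub hz
    set x : ComplexProjectiveSpace 1 := CodimTwoData.linePt 0 z with hx
    set de : EuclideanSpace ℝ (Fin 4) →L[ℝ] EuclideanSpace ℝ (Fin m) := mfderiv (𝓡 4) 𝓘(ℝ, EuclideanSpace ℝ (Fin m)) D.e (D.b x) with hde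
    set du : ℂ →L[ℝ] EuclideanSpace ℝ (Fin 4) := mfderiv 𝓘(ℝ, ℂ) (𝓡 4) u z with hdu
    have hN1 : de (Nf z).1 = n z := (hNf z hz').1
    have hN2 : de (Nf z).2 = J x (n z) := (hNf z hz').2
    -- `de ∘ du = df ∘ dσ`, values in `TS`
    have h1 : HasMFDerivAt 𝓘(ℝ, ℂ) 𝓘(ℝ, EuclideanSpace ℝ (Fin m)) (fun z => D.e (u z)) z (de.comp du) :=
      (by rw [hde, hbu]; exact (D.mdifferentiableAt_e _).hasMFDerivAt : HasMFDerivAt (𝓡 4) 𝓘(ℝ, EuclideanSpace ℝ (Fin m)) D.e (u z) de).comp z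
        ((hu z).mdifferentiableAt (by simp)).hasMFDerivAt
    have h2' := (D.mdifferentiableAt_f x).hasMFDerivAt.comp z ((hσ z).mdifferentiableAt (by simp)).hasMFDerivAt
    have h2 : HasMFDerivAt 𝓘(ℝ, ℂ) 𝓘(ℝ, EuclideanSpace ℝ (Fin m)) (fun z => D.f (CodimTwoData.linePt 0 z)) z
        ((mfderiv (𝓡 2) 𝓘(ℝ, EuclideanSpace ℝ (Fin m)) D.f x).comp (mfderiv 𝓘(ℝ, ℂ) (𝓡 2) (CodimTwoData.linePt 0) z)) := h2'
    have hfσ : (fun z => D.e (u z)) = fun z => D.f (CodimTwoData.linePt 0 z) := by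
      funext w; show D.e (u w) = D.e (D.b (CodimTwoData.linePt 0 w)); rw [hbu]
    have h1' : HasMFDerivAt 𝓘(ℝ, ℂ) 𝓘(ℝ, EuclideanSpace ℝ (Fin m)) (fun z => D.f (CodimTwoData.linePt 0 z)) z (de.comp du) :=
      h1.congr_of_eventuallyEq (Filter.Eventually.of_forall fun w => (congrFun hfσ w).symm)
    have h3 : de.comp du = (mfderiv (𝓡 2) 𝓘(ℝ, EuclideanSpace ℝ (Fin m)) D.f x).comp (mfderiv 𝓘(ℝ, ℂ) (𝓡 2) (CodimTwoData.linePt 0) z) :=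
      h1'.mfderiv.symm.trans h2.mfderiv
    have hTS : ∀ h : ℂ, de (du h) ∈ D.TS x := fun h => by
      have h3h : de (du h) = (mfderiv (𝓡 2) 𝓘(ℝ, EuclideanSpace ℝ (Fin m)) D.f x) (mfderiv 𝓘(ℝ, ℂ) (𝓡 2) (CodimTwoData.linePt 0) z h) :=
        DFunLike.congr_fun h3 h
      exact h3h ▸ D.mfderiv_f_mem_TS x _
    -- the sphere map in the chart is `u`
    have hdb : mfderiv 𝓘(ℝ, ℂ) (𝓡 4) (fun z => D.b (CodimTwoData.linePt 0 z)) z = du := by rw [hbu']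
    rw [hdb]
    suffices h : LinearIndependent ℝ (![du (1 : ℂ), du Complex.I, (Nf z).1, (Nf z).2] : Fin 4 → EuclideanSpace ℝ (Fin 4)) by exact h
    rw [Fintype.linearIndependent_iff]
    intro c hc
    -- apply `de`: tangential part + normal part = 0
    have hsum : (de (du ((c 0 : ℂ) + (c 1 : ℂ) * Complex.I)) : EuclideanSpace ℝ (Fin m)) + ((c 2) • n z + (c 3) • J x (n z)) = 0 := by
      have := congrArg de hc
      simp only [Fin.sum_univ_four, Matrix.cons_val_zero, Matrix.cons_val_one, Matrix.cons_val, map_add, map_smul, map_zero] at this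
      rw [hN1, hN2] at this
      have e1 : (de (du ((c 0 : ℂ) + (c 1 : ℂ) * Complex.I)) : EuclideanSpace ℝ (Fin m)) = c 0 • de (du (1 : ℂ)) + c 1 • de (du Complex.I) := by
        rw [map_add, map_add]
        congr 1
        · rw [show ((c 0 : ℝ) : ℂ) = (c 0 : ℝ) • (1 : ℂ) by simp, ContinuousLinearMap.map_smul_of_tower, ContinuousLinearMap.map_smul_of_tower]
        · rw [show ((c 1 : ℝ) : ℂ) * Complex.I = (c 1 : ℝ) • Complex.I by simp [Complex.real_smul], ContinuousLinearMap.map_smul_of_tower,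
            ContinuousLinearMap.map_smul_of_tower]
      rw [e1]
      convert this using 1
      abel
    have hT : de (du ((c 0 : ℂ) + (c 1 : ℂ) * Complex.I)) ∈ D.TS x := hTS _
    have hN : (c 2) • n z + (c 3) • J x (n z) ∈ D.F x := (D.F x).add_mem ((D.F x).smul_mem _ (hnF z hz')) ((D.F x).smul_mem _ (hJ.apply_mem _ _))
    have hNorth : (c 2) • n z + (c 3) • J x (n z) ∈ (D.TS x)ᗮ := (D.mem_F.1 hN).1
    -- both summands vanish
    have hN0 : (c 2) • n z + (c 3) • J x (n z) = 0 := by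
      have hT' : de (du ((c 0 : ℂ) + (c 1 : ℂ) * Complex.I)) = -((c 2) • n z + (c 3) • J x (n z)) := eq_neg_of_add_eq_zero_left hsum
      have hmem : (c 2) • n z + (c 3) • J x (n z) ∈ D.TS x := by
        have := (D.TS x).neg_mem hT
        rw [hT', neg_neg] at this
        exact this
      exact Submodule.inf_orthogonal_eq_bot (D.TS x) ▸ (Submodule.mem_inf.2 ⟨hmem, hNorth⟩ : _ ∈ D.TS x ⊓ (D.TS x)ᗮ) |> fun h => by
        simpa using h
    have hT0 : du ((c 0 : ℂ) + (c 1 : ℂ) * Complex.I) = 0 := by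
      have h' : (de (du ((c 0 : ℂ) + (c 1 : ℂ) * Complex.I)) : EuclideanSpace ℝ (Fin m)) = 0 := by
        rw [hN0, add_zero] at hsum; exact hsum
      have hinj : Function.Injective de := by rw [hde]; exact D.hde (D.b x)
      exact hinj (h'.trans (map_zero de).symm)
    have hinju : Function.Injective du := by rw [hdu]; exact himm z
    have hc01 : (c 0 : ℂ) + (c 1 : ℂ) * Complex.I = 0 := hinju (hT0.trans (map_zero du).symm)
    have hc0 : c 0 = 0 := by simpa using congrArg Complex.re hc01
    have hc1 : c 1 = 0 := by simpa using congrArg Complex.im hc01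
    -- normal part: `n`, `J n` independent
    have hnz : n z ≠ 0 := (hn z hz').2
    have hc23 : c 2 = 0 ∧ c 3 = 0 := by
      have hB := congrArg (fun w => inner ℝ w (n z)) hN0
      have hB' := congrArg (fun w => inner ℝ w (J x (n z))) hN0
      simp only [inner_add_left, inner_smul_left, inner_zero_left, RCLike.conj_to_real, hJ.inner_apply_self x (n z) (hnF z hz'),
        mul_zero, add_zero, real_inner_self_eq_norm_sq, hJ.norm_apply x (n z) (hnF z hz')] at hB hB'
      rw [real_inner_comm, hJ.inner_apply_self x (n z) (hnF z hz'), mul_zero, zero_add] at hB'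
      have hnn : ‖n z‖ ^ 2 ≠ 0 := pow_ne_zero 2 (norm_ne_zero_iff.2 hnz)
      exact ⟨(mul_eq_zero.1 hB).resolve_right hnn, (mul_eq_zero.1 hB').resolve_right hnn⟩
    intro i
    fin_cases i
    · exact hc0
    · exact hc1
    · exact hc23.1
    · exact hc23.2
  -- STEP 3: per-crossing local indices (helper_nwtCrossingIndex with the chart parametrisation `z ↦ b (linePt 0 z)` of `Σ`)
  obtain ⟨bE, hbE⟩ : ∃ bE : Module.Basis (Fin 4) ℝ (EuclideanSpace ℝ (Fin 4)),
      bE = (Module.finBasis ℝ (EuclideanSpace ℝ (Fin 4))).reindex (finCongr finrank_euclideanSpace_fin) := ⟨_, rfl⟩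
  have hzO : ∀ ζ ∈ ZK, zc ζ ∈ O := fun ζ hζ => by rw [hOdef, mem_ball_zero_iff]; exact hRSZ ζ hζ
  have hu' : ContMDiff 𝓘(ℝ, ℂ) (𝓡 4) ∞ (fun z => D.b (CodimTwoData.linePt 0 z)) := by rw [hbu']; exact hu
  have hgfun : (fun z => g (D.b (CodimTwoData.linePt 0 z))) = fun z => g (u z) := funext fun z => by rw [hbu]
  have hcross : ∀ ζ ∈ ZK, ∃ d q r₁ : ℝ, d ≠ 0 ∧ q ≠ 0 ∧ 0 < r₁ ∧
      d * bE.det ![mfderiv 𝓘(ℝ, ℂ) (𝓡 4) (fun z => D.b (CodimTwoData.linePt 0 z)) (zc ζ) (1 : ℂ),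
        mfderiv 𝓘(ℝ, ℂ) (𝓡 4) (fun z => D.b (CodimTwoData.linePt 0 z)) (zc ζ) Complex.I, (Nf (zc ζ)).1, (Nf (zc ζ)).2] =
        ‖n (zc ζ)‖ ^ 4 * (bE.det ![mfderiv 𝓘(ℝ, ℂ × ℂ) (𝓡 4) Φ (ζ, s) (1, 0), mfderiv 𝓘(ℝ, ℂ × ℂ) (𝓡 4) Φ (ζ, s) (Complex.I, 0),
          mfderiv 𝓘(ℝ, ℂ × ℂ) (𝓡 4) Φ (ζ, s) (0, 1), mfderiv 𝓘(ℝ, ℂ × ℂ) (𝓡 4) Φ (ζ, s) (0, Complex.I)] * q) ∧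
      (∀ r : ℝ, 0 < r → r ≤ r₁ → IsNonvanishingLoop (fun θ => φ (circleLoop ζ r θ)) ∧
        wind (fun θ => φ (circleLoop ζ r θ)) = (if 0 < d then 1 else -1)) ∧
      (∀ r : ℝ, 0 < r → r ≤ r₁ → wind (fun θ => g (u (circleLoop (zc ζ) r θ)) - s) = (if 0 < q then 1 else -1)) := by
    intro ζ hζ
    have hzc' : zc ζ ∈ closedBall (0 : ℂ) RS := hOsub (hzO ζ hζ)
    obtain ⟨ρ, hρ, htc, htP⟩ := ht ζ hζ
    have hreg' : Function.Surjective (mfderiv 𝓘(ℝ, ℂ) 𝓘(ℝ, ℂ) (fun z => g (D.b (CodimTwoData.linePt 0 z))) (zc ζ)) := by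
      rw [hgfun]; exact hreg ζ hζ
    obtain ⟨d, q, r₁, hd, hq, hr₁, hid, hwφ, hwg⟩ := helper_nwtCrossingIndex m X D J ε δ Rot sec Φ g UK
      (fun z => D.b (CodimTwoData.linePt 0 z)) s ζ (zc ζ) (n (zc ζ)) (Nf (zc ζ)).1 (Nf (zc ζ)).2 t φ ρ bE hJ hε hδ hδε hPc hRotc
      hOPF hRotIn hSecIn hΦ hΦd hUK hg hΦU hgΦ hu' (fun _ => rfl) ((hzc ζ hζ).trans (hbu _).symm) hreg' (hnF _ hzc')
      (hn _ hzc').2 (hNf _ hzc').1 (hNf _ hzc').2 hρ htc htP hφ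
    refine ⟨d, q, r₁, hd, hq, hr₁, hid, hwφ, fun r hr hrle => ?_⟩
    simpa only [hbu] using hwg r hr hrle
  -- STEP 4: sign constancy along `Σ` (frame `[dΣ | N₁ N₂]` over the disc `O`) and along `K` (`Φ` a local diffeo on `ℂ × ℂ`)
  have hconstB := helper_posFrameAlongSurfaceConstC m X (ComplexProjectiveSpace 1) D o (CodimTwoData.linePt 0) n
    (fun z => J (CodimTwoData.linePt 0 z) (n z)) (fun z => (Nf z).1) (fun z => (Nf z).2) O (by rw [hOdef]; exact isOpen_ball)
    (by rw [hOdef]; exact (convex_ball (0 : ℂ) RS).isPreconnected) hσ.contMDiffOn (hnc.mono hOsub)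
    (((hJ.continuous.comp (CodimTwoData.continuous_linePt 0)).continuousOn.clm_apply (hnc.mono hOsub)))
    (fun z hz => hNf z (hOsub hz)) hlin
  have hconstP := helper_posFrameOfLocalDiffeoConst X o Φ univ isOpen_univ isPreconnected_univ hΦ.contMDiffOn (fun q _ => hΦd q)
  -- bridge `IsPosFrame ↔ 0 < sign * bE.det`
  have hbr : ∀ (x : X) (w : Fin 4 → EuclideanSpace ℝ (Fin 4)),
      o.IsPosFrame x (w ∘ ⇑(finCongr finrank_euclideanSpace_fin)) ↔ 0 < o.sign x * bE.det w := by
    intro x w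
    rw [SmoothOrientation.IsPosFrame, hbE, Module.Basis.det_reindex]
  have hdetB : ∀ z ∈ O, bE.det ![mfderiv 𝓘(ℝ, ℂ) (𝓡 4) (fun z => D.b (CodimTwoData.linePt 0 z)) z (1 : ℂ),
      mfderiv 𝓘(ℝ, ℂ) (𝓡 4) (fun z => D.b (CodimTwoData.linePt 0 z)) z Complex.I, (Nf z).1, (Nf z).2] ≠ 0 := fun z hz => by
    rw [hbE, Module.Basis.det_reindex]
    exact det_ne_zero_of_linearIndependent _ ((hlin z hz).comp _ (finCongr finrank_euclideanSpace_fin).injective)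
  have h0O : (0 : ℂ) ∈ O := by rw [hOdef]; exact mem_ball_self hRS
  -- the two constant characters
  obtain ⟨SB, hSB⟩ : ∃ SB : ℤ, SB = if 0 < o.sign (D.b (CodimTwoData.linePt 0 0)) * bE.det ![mfderiv 𝓘(ℝ, ℂ) (𝓡 4)
      (fun z => D.b (CodimTwoData.linePt 0 z)) 0 (1 : ℂ), mfderiv 𝓘(ℝ, ℂ) (𝓡 4) (fun z => D.b (CodimTwoData.linePt 0 z)) 0 Complex.I,
      (Nf 0).1, (Nf 0).2] then 1 else -1 := ⟨_, rfl⟩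
  obtain ⟨SP, hSP⟩ : ∃ SP : ℤ, SP = if 0 < o.sign (Φ (0, s)) * bE.det ![mfderiv 𝓘(ℝ, ℂ × ℂ) (𝓡 4) Φ (0, s) (1, 0),
      mfderiv 𝓘(ℝ, ℂ × ℂ) (𝓡 4) Φ (0, s) (Complex.I, 0), mfderiv 𝓘(ℝ, ℂ × ℂ) (𝓡 4) Φ (0, s) (0, 1),
      mfderiv 𝓘(ℝ, ℂ × ℂ) (𝓡 4) Φ (0, s) (0, Complex.I)] then 1 else -1 := ⟨_, rfl⟩
  choose! dζ qζ rζ hd hq hr hid hwφ hwg using hcross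
  have hkey : ∀ ζ ∈ ZK, (if 0 < dζ ζ then (1 : ℤ) else -1) = SB * SP * (if 0 < qζ ζ then 1 else -1) := by
    intro ζ hζ
    have hz := hzO ζ hζ
    -- constancy transported through the bridge
    have hB := hconstB (zc ζ) hz 0 h0O
    rw [hbr, hbr] at hB
    have hP := hconstP (ζ, s) (mem_univ _) (0, s) (mem_univ _)
    rw [hbr, hbr] at hP
    have hsg : o.sign (Φ (ζ, s)) = o.sign (D.b (CodimTwoData.linePt 0 (zc ζ))) := by rw [hzc ζ hζ, hbu]
    rw [hsg] at hP
    -- multiply the crossing identity by the orientation sign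
    have hσ1 : o.sign (D.b (CodimTwoData.linePt 0 (zc ζ))) * o.sign (D.b (CodimTwoData.linePt 0 (zc ζ))) = 1 := o.sign_mul_self _
    have hτ4 : 0 < ‖n (zc ζ)‖ ^ 4 := pow_pos (norm_pos_iff.2 (hn _ (hOsub hz)).2) 4
    have hid' := hid ζ hζ
    have hid2 : dζ ζ * (o.sign (D.b (CodimTwoData.linePt 0 (zc ζ))) * bE.det ![mfderiv 𝓘(ℝ, ℂ) (𝓡 4)
        (fun z => D.b (CodimTwoData.linePt 0 z)) (zc ζ) (1 : ℂ), mfderiv 𝓘(ℝ, ℂ) (𝓡 4) (fun z => D.b (CodimTwoData.linePt 0 z)) (zc ζ)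
        Complex.I, (Nf (zc ζ)).1, (Nf (zc ζ)).2]) = ‖n (zc ζ)‖ ^ 4 * ((o.sign (D.b (CodimTwoData.linePt 0 (zc ζ))) *
        bE.det ![mfderiv 𝓘(ℝ, ℂ × ℂ) (𝓡 4) Φ (ζ, s) (1, 0), mfderiv 𝓘(ℝ, ℂ × ℂ) (𝓡 4) Φ (ζ, s) (Complex.I, 0),
          mfderiv 𝓘(ℝ, ℂ × ℂ) (𝓡 4) Φ (ζ, s) (0, 1), mfderiv 𝓘(ℝ, ℂ × ℂ) (𝓡 4) Φ (ζ, s) (0, Complex.I)]) * qζ ζ) := by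
      rw [mul_left_comm, hid']; ring
    have hbne : o.sign (D.b (CodimTwoData.linePt 0 (zc ζ))) * bE.det ![mfderiv 𝓘(ℝ, ℂ) (𝓡 4)
        (fun z => D.b (CodimTwoData.linePt 0 z)) (zc ζ) (1 : ℂ), mfderiv 𝓘(ℝ, ℂ) (𝓡 4) (fun z => D.b (CodimTwoData.linePt 0 z)) (zc ζ)
        Complex.I, (Nf (zc ζ)).1, (Nf (zc ζ)).2] ≠ 0 := mul_ne_zero (o.sign_ne_zero _) (hdetB _ hz)
    rw [helper_nwtIndexSum_sgnRule hτ4 (hd ζ hζ) (hq ζ hζ) hbne hid2, hSB, hSP]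
    congr 2
    · exact if_congr hB rfl rfl
    · exact if_congr hP rfl rfl
  -- STEP 5: a common radius and the vanishing sum
  obtain ⟨r₀, hr₀, hsum0⟩ := hcount
  obtain ⟨rm, hrm, hrmle, hrm0⟩ : ∃ rm : ℝ, 0 < rm ∧ (∀ ζ ∈ ZK, rm ≤ rζ ζ) ∧ rm ≤ r₀ := by
    refine ⟨(insert r₀ (ZK.image rζ)).min' (Finset.insert_nonempty _ _), ?_,
      fun ζ hζ => Finset.min'_le _ _ (Finset.mem_insert_of_mem (Finset.mem_image_of_mem rζ hζ)),
      Finset.min'_le _ _ (Finset.mem_insert_self _ _)⟩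
    have hmem := Finset.min'_mem (insert r₀ (ZK.image rζ)) (Finset.insert_nonempty _ _)
    rcases Finset.mem_insert.1 hmem with h | h
    · rw [h]; exact hr₀
    · obtain ⟨ζ, hζ, hζe⟩ := Finset.mem_image.1 h
      rw [← hζe]; exact hr ζ hζ
  refine ⟨rm, hrm, fun r hr0 hrle => ⟨fun ζ hζ => (hwφ ζ hζ r hr0 (hrle.trans (hrmle ζ hζ))).1, ?_⟩⟩
  have h1 : ∑ ζ ∈ ZK, wind (fun θ => φ (circleLoop ζ r θ)) = ∑ ζ ∈ ZK, SB * SP * (if 0 < qζ ζ then 1 else -1) :=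
    Finset.sum_congr rfl fun ζ hζ => by rw [(hwφ ζ hζ r hr0 (hrle.trans (hrmle ζ hζ))).2, hkey ζ hζ]
  have h2 : ∑ ζ ∈ ZK, wind (fun θ => g (u (circleLoop (zc ζ) r θ)) - s) = ∑ ζ ∈ ZK, (if 0 < qζ ζ then (1 : ℤ) else -1) :=
    Finset.sum_congr rfl fun ζ hζ => hwg ζ hζ r hr0 (hrle.trans (hrmle ζ hζ))
  rw [h1, ← Finset.mul_sum, ← h2, hsum0 r hr0 (hrle.trans hrm0), mul_zero]

end Summit.SmoothPoincare4.SmoothPoincare4.Theorems.GromovRecognitionRelEnd.CrossCapLaurent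

end
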